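import Literature.MathematicalPhysics.QuantumFieldTheory.Balaban1983to89.B8Ineq159FlatShellModeVacuity
import Literature.MathematicalPhysics.QuantumFieldTheory.Balaban1983to89.B8IdxB8LawsB

/-!
# `Balaban1983to89.B8Ineq159FlatCubeMemberPrinted` — [Balaban1985RegularSpaces] (1.31) p. 82 ∕ [Balaban1984PropagatorsII] (2.3) p. 224: PRINT'S
# CONSTRAINT-BOND CLASS AT THE CUBE MEMBER `{□_j}` OF (1.131) — INNER AND CROSSING BONDS («at least one end-point in Λ_j, no end-point inside
# □_{j+1}^{(j)}») — and the NAMED FACT «(1.59) at `U₀ = 1` on the cube member» = [Balaban1985BackgroundPropagators] Thm 3.3 at `U = 1` (Dirichlet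
# exterior), stated over that class: the REPAIRED target of N05's flat p6 road after the shell-mode certificate `B8Ineq159FlatShellModeVacuity`

statement-level skeleton of published theorems with citation tags; proofs where landed; nothing here is a claim about the
Yang–Mills mass gap

`[Balaban1985RegularSpaces]` ("B8", CMP **99** (1985) 75–102) (1.31) p. 82 («Q(Ū₀ʲ⁻¹, (iLʲη)⁻¹ log((\overline{U₁U₀})ʲ⁻¹_{Γ_{b₋,x}} …)) … All sites of the
contours Γ_{b₋,x} belong to Λ_{j−1}»), (1.5)–(1.6) p. 77, (1.58)–(1.59) p. 86, Prop. 3 p. 87, Thm 4 p. 88, Prop. 6 p. 99, (1.131)–(1.132) p. 99, p. 98;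
[B6] = `[Balaban1984PropagatorsII]` (CMP **96** (1984) 223–250) (2.3) p. 224 («Λ_j = Ω_j^{(j)} ∖ Ω_{j+1}^{(j)} … for the sets of sites and the sets of
bonds»; bonds of `Ω` = «at least one end-point of b belongs to Ω»), (2.6) p. 224; [4] = `[Balaban1985BackgroundPropagators]` (CMP **99** (1985) 389–434)
Thm 3.3 p. 399, (3.47) p. 398.  PDF held: `paper:balaban1985-cmp99-regular-spaces-gauge-fixing`, `paper:balaban1984-cmp96-propagators-rt-ii`.

CITATION HEADER (lean-in-tree rule).  Cell `pub-ymgap` (YM Track A, HUMAN RULING D-0062), DAG node N05 = [B8], seat `pub-ymgap-dag-n05-c` (g11; R134 s1).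
WHY: `B8Ineq159FlatShellModeVacuity` (this seat, p572834) certified that the β-edition flat (1.59) clauses over `B8CubeMemberZd.cubeLamB` are FALSE at
every cube member with `k ≥ 1` — `cubeLamB` (and, generically, `B8IdxB8LawsB.towerBonds`, the maximal class the `ZdIdx` bond laws admit) contains NO
crossing bond, so one pure-gauge shell mode per level survives (the emptiness itself was already kernel-recorded as bookkeeping by this base's g3,
`B8CubeMemberIdxB8Laws.mem_cubeLamB_iff_inner` ∕ `cubeLamB_eq_inner`, «recorded for the desk rows reading (1.37) and the (1.59) socket's |B₁|-term»;
the zero-mode CONSEQUENCE is p572834's).  THIS FILE (i) proves the GENERIC emptiness `towerBonds_inner_of_printTower` (every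
print-like tower: `Λ_{j′} ∩ Ω_{j′+1}^{(j′)} = ∅`), (ii) types PRINT'S class `cubeLamBP` at the cube member — lit-balaban p21's reading
`B6SectADomainsV1.Domains.LamBond` «at least one end-point in Ω_j^{(j)}, no end-point deep» at truncation `m` — with `cubeLamB ⊆ cubeLamBP`, `CrossB □₀ ⊆
cubeLamBP … 0` and an INHABITED crossing member at level `1`, and (iii) states the named fact `Ineq159FlatCubeMemberPrinted d L` = (1.59) at `U₀ = 1` for
ℂ-valued bond functions in the flat Landau gauge (1.38) on the cube member, averaging datum over `cubeLamBP`, Dirichlet exterior with the outer-layer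
allowance, three members (`|A|₍₋₁₎`, `|∇A|₍₋₂₎`, `|ΔA|₍₋₃₎`) in print's pointwise form «on Ω_j», constants on `d, L` only, thresholds on print's p. 98 big-block
sub-lattice with `M_h = Lˢ` — the statement a transplant of the torus-with-level-0 (1.59) (lit-balaban G-F3′-L0, `Constr` = `LamBond`) delivers;
(iv, v1.1 §3) the BOX LAW of print's class: the fine box `Bʲ(c₋) ∪ Bʲ(c₊)` of a level-`j ≥ 1` bond of `cubeLamBP` lies in `□_{j−1}` (`L ≤ ρ`;
`cubeLamBP_box_subset_pred` — dag-n05-e CONSUMER-REQS (R1), the guard «box ⊂ Ω_{j−1}» of the edition-γ driver), and at level `0` a bond of the class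
touches `□₀` (`cubeLamBP_zero_bondTouches`).

HONEST SCOPE.  Definitions + bookkeeping + ONE named published fact (`def … : Prop`, NOT proved here: [4] Thm 3.3 at `U = 1` on the cube member is OPEN
in the tree); nothing of Bałaban's analysis asserted as a theorem; count-neutral; N05 NOT discharged; one finite `T⁴` programme at fixed `ε`, Bałaban as
printed; nothing continuum ∕ ℝ⁴ ∕ OS ∕ mass-gap ∕ Clay.  No `sorry`, no `instance`, no `notation`.  Unit `pub-ymgap-dag-n05-c` (g11), 2026-08-27.
-/

noncomputable section

namespace Literature.MathematicalPhysics.QuantumFieldTheory.Balaban1983to89.B8Ineq159FlatCubeMemberPrinted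

open B7Prop1Explicit B7Prop2Explicit B7Prop1Local
open B7Prop4GeneralLevels (linCovIter)
open B8Ineq132 (covDerivFwd BondTouches Under)
open B8Eq140Level (SideTouches)
open B8Eq146AExpansion (iEta)
open B8Eq155JBound (Jcur)
open B8Eq138LandauZd (IsLandau138 covLap)
open B8Eq131Cubes (cube sqLo sqHi inLo inHi cube_succ_subset mem_cube_iff)
open B8Eq131CubesAdmissible (cubeFam cubeFam_false_zero smul_mem_cube_iff smul_mem_cube_succ_iff add_mem_cube_of_mem_succ)
open B8CubeMemberZd (cubeLam cubeLamS cubeLamB mem_cubeLam_zero_iff cubeLamS_of_lt cubeLamS_self inBox_sq_of_mem_cubeLamS smul_mem_bondBox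
  smul_add_mem_bondBox)
open B8IdxB8LawsB (towerBonds)
open B9SupplySockB9P3ZdBeta (CrossB)
open B8Ineq159FlatShellModeVacuity (cubeLamB_ends_inBox_sq mem_cubeLamB_iff_inner one_le_gs sqLo_inBox_one)

export B7Prop1Explicit (Site)

variable {d : ℕ}

/-! ## §0 The located defect is GENERIC: `towerBonds` has no crossing bond over any print-like tower -/

/-- ★ **THE MAXIMAL `ZdIdx` BOND CLASS HAS NO CROSSING BOND OVER A PRINT-LIKE TOWER**: if `Λ_{j′} ∩ Ω_{j′+1}^{(j′)} = ∅` for all `j′` (read on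
the `j′`-lattice: `x ∈ Λ j′ ⇒ L^{j′}•x ∉ Ω (j′+1)`; (1.5) «Λ_j = Ω_j^{(j)} ∖ Ω_{j+1}^{(j)}»), then a bond of `B8IdxB8LawsB.towerBonds L Ω Λ j` (box in
`Ω_j` ∧ inner-or-crossing) is INNER: both ends in `Λ j`.  So no lawful `ZdIdx` member carries print's (1.31) crossing contours.
[cite: Balaban1985RegularSpaces, (1.5) p.77, (1.31) p.82, p.86 («𝔅_k»); Balaban1984PropagatorsII, (2.3) p.224] -/
theorem towerBonds_inner_of_printTower {L : ℕ} (hL : 1 ≤ L) {Ω Λ : ℕ → Set (Site d)}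
    (hΛΩ : ∀ (j' : ℕ) (x : Site d), x ∈ Λ j' → ((L : ℤ) ^ j') • x ∉ Ω (j' + 1)) {j : ℕ} {c : Site d × Fin d}
    (hc : c ∈ towerBonds L Ω Λ j) : c.1 ∈ Λ j ∧ c.1 + e c.2 ∈ Λ j := by
  have hL1 : (1 : ℤ) ≤ (L : ℤ) := by exact_mod_cast hL
  rcases hc.2 with h | ⟨j', hjj', hsub, -⟩ | ⟨j', hjj', -, hsub⟩
  · exact h
  · exfalso
    subst hjj'
    have hx := hsub ((L : ℤ) • c.1) (le_refl _) (by
      intro i; simp only [Pi.add_apply, B8Thm2LogB.blockTop, Pi.smul_apply, smul_eq_mul]; linarith)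
    refine hΛΩ j' _ hx ?_
    rw [smul_smul, ← pow_succ]
    exact hc.1 _ (smul_mem_bondBox hL (j' + 1) c.1 c.2)
  · exfalso
    subst hjj'
    have hx := hsub ((L : ℤ) • (c.1 + e c.2)) (le_refl _) (by
      intro i; simp only [Pi.add_apply, B8Thm2LogB.blockTop, Pi.smul_apply, smul_eq_mul]; linarith)
    refine hΛΩ j' _ hx ?_
    rw [smul_smul, ← pow_succ]
    exact hc.1 _ (smul_add_mem_bondBox hL (j' + 1) c.1 c.2)

/-- **The cube member's truncated tower is print-like**: a site of `cubeLamS … m j′` with `j′ < m ≤ k` is not inside `□_{j′+1}` (`Λ_{j′} = □_{j′}^{(j′)} ∖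
□_{j′+1}^{(j′)}`). [cite: Balaban1985RegularSpaces, (1.131) p.99, (1.5) p.77] -/
theorem cubeLamS_smul_notMem_cube_succ {L : ℕ} (hL : 1 ≤ L) (a : Site d) (M ρ : ℕ) {k m j' : ℕ} (hj' : j' < m) (hmk : m ≤ k)
    {x : Site d} (hx : x ∈ cubeLamS L a M ρ k m j') : ((L : ℤ) ^ j') • x ∉ cubeFam false L a M ρ k (j' + 1) := by
  rw [cubeLamS_of_lt L a M ρ k hj'] at hx
  rw [B8Eq131CubesAdmissible.cubeFam_false_of_le L a M ρ (by omega : j' + 1 ≤ k)]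
  intro h
  exact hx.2 (by omega) ((smul_mem_cube_succ_iff hL a M ρ (by omega) x).1 h)

/-! ## §1 Print's constraint-bond class at the cube member: inner AND crossing bonds -/

/-- **PRINT'S CONSTRAINT-BOND CLASS AT LEVEL `j` OF THE TRUNCATION `m` OF THE CUBE MEMBER** ([B6] (2.3) for bonds, (1.31)'s contours): a level-`j`
bond `c = ⟨c₋, c₋ + e_κ⟩` with AT LEAST ONE end-point in `□_j^{(j)}` and NO end-point inside `□_{j+1}^{(j)}` when `j < m` (nothing is «deep» at the
truncation level `m`; empty above `m`).  At `j ≥ 1` this is the INNER bonds of `Λ_j` together with the bonds STICKING OUT of `□_j^{(j)}` into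
`B(Λ_{j−1})` (print's crossing bonds, fine box in `□_{j−1}`); at `j = 0` it is every bond with an end in `□₀` and no end in `□₁` (so `CrossB □₀` included).
Lit-balaban p21's `B6SectADomainsV1.Domains.LamBond` read at the cube member. [cite: Balaban1984PropagatorsII, (2.3) p.224; Balaban1985RegularSpaces, (1.31) p.82, (1.131) p.99] -/
def cubeLamBP (L : ℕ) (a : Site d) (M ρ k m j : ℕ) : Set (Site d × Fin d) :=
  {c | j ≤ m ∧ (InBox (sqLo L a ρ k j) (sqHi L a M ρ k j) c.1 ∨ InBox (sqLo L a ρ k j) (sqHi L a M ρ k j) (c.1 + e c.2)) ∧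
    (j < m → ¬ InBox (inLo L a ρ k j) (inHi L a M ρ k j) c.1 ∧ ¬ InBox (inLo L a ρ k j) (inHi L a M ρ k j) (c.1 + e c.2))}

/-- Membership, unfolded (`Iff.rfl`). [cite: Balaban1984PropagatorsII, (2.3) p.224] -/
theorem mem_cubeLamBP_iff (L : ℕ) (a : Site d) (M ρ k m j : ℕ) (c : Site d × Fin d) :
    c ∈ cubeLamBP L a M ρ k m j ↔ j ≤ m ∧
      (InBox (sqLo L a ρ k j) (sqHi L a M ρ k j) c.1 ∨ InBox (sqLo L a ρ k j) (sqHi L a M ρ k j) (c.1 + e c.2)) ∧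
      (j < m → ¬ InBox (inLo L a ρ k j) (inHi L a M ρ k j) c.1 ∧ ¬ InBox (inLo L a ρ k j) (inHi L a M ρ k j) (c.1 + e c.2)) :=
  Iff.rfl

/-- A site of `cubeLamS … m j` (`j ≤ m ≤ k`) lies in `□_j^{(j)}` and, for `j < m`, not inside `□_{j+1}`. [cite: Balaban1985RegularSpaces, (1.131) p.99, (1.5) p.77] -/
theorem inBox_and_notIn_of_mem_cubeLamS (L : ℕ) (a : Site d) (M ρ : ℕ) {k m j : ℕ} (hmk : m ≤ k) {z : Site d}
    (hz : z ∈ cubeLamS L a M ρ k m j) :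
    InBox (sqLo L a ρ k j) (sqHi L a M ρ k j) z ∧ (j < m → ¬ InBox (inLo L a ρ k j) (inHi L a M ρ k j) z) := by
  refine ⟨inBox_sq_of_mem_cubeLamS hz, fun hjm => ?_⟩
  rw [cubeLamS_of_lt L a M ρ k hjm] at hz
  exact hz.2 (by omega)

/-- **`cubeLamB ⊆ cubeLamBP`**: the typed (inner-only) class is part of print's class (`j ≤ m ≤ k`, `L ≥ 1`). [cite: Balaban1985RegularSpaces, (1.31) p.82; Balaban1984PropagatorsII, (2.3) p.224] -/
theorem cubeLamB_subset_cubeLamBP {L : ℕ} (hL : 1 ≤ L) (a : Site d) (M ρ : ℕ) {k m j : ℕ} (hjm : j ≤ m) (hmk : m ≤ k) :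
    cubeLamB L a M ρ k m j ⊆ cubeLamBP L a M ρ k m j := by
  intro c hc
  obtain ⟨-, h1, h2⟩ := (mem_cubeLamB_iff_inner hL a M ρ hjm hmk c).1 hc
  have g1 := inBox_and_notIn_of_mem_cubeLamS L a M ρ hmk h1
  have g2 := inBox_and_notIn_of_mem_cubeLamS L a M ρ hmk h2
  exact ⟨hjm, Or.inl g1.1, fun hj => ⟨g1.2 hj, g2.2 hj⟩⟩

/-- **The β edition's `CrossB □₀` bonds are level-`0` members of print's class** (`L ≥ 1`, `k ≥ 1`, collar `ρ ≥ 1`; any truncation `m`): one end in `□₀`, the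
other outside `□₀`, hence (collar) neither in `□₁`. [cite: Balaban1985RegularSpaces, p.77 (bond convention), p.98; Balaban1984PropagatorsII, (2.3) p.224 («Λ₀ = Ω₁ᶜ»)] -/
theorem mem_cubeLamBP_zero_of_crossB {L : ℕ} (hL : 1 ≤ L) (a : Site d) (M : ℕ) {ρ : ℕ} (hρ : 1 ≤ ρ) {k : ℕ} (hk : 1 ≤ k) (m : ℕ)
    {b : Site d × Fin d} (hb : CrossB (cubeFam false L a M ρ k 0) b) : b ∈ cubeLamBP L a M ρ k m 0 := by
  obtain ⟨hbt, hnot⟩ := hb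
  rw [cubeFam_false_zero] at hbt hnot
  have h10 : cube L a M ρ k 1 ⊆ cube L a M ρ k 0 := cube_succ_subset (by omega)
  have hcol : ∀ x ∈ cube L a M ρ k 1, ∀ μ : Fin d, x + e μ ∈ cube L a M ρ k 0 ∧ x - e μ ∈ cube L a M ρ k 0 := by
    intro x hx μ
    have hb : ∀ i, |(e μ : Site d) i| ≤ ((ρ * L ^ 0 : ℕ) : ℤ) := by
      intro i
      rw [pow_zero, mul_one]
      change |(Pi.single μ (1 : ℤ) : Fin d → ℤ) i| ≤ (ρ : ℤ)
      rw [Pi.single_apply]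
      split_ifs
      · simp only [abs_one]; exact_mod_cast hρ
      · simp
    have hb' : ∀ i, |(-(e μ) : Site d) i| ≤ ((ρ * L ^ 0 : ℕ) : ℤ) := fun i => by rw [Pi.neg_apply, abs_neg]; exact hb i
    exact ⟨add_mem_cube_of_mem_succ (j := 0) (by omega) hx hb,
      by rw [sub_eq_add_neg]; exact add_mem_cube_of_mem_succ (j := 0) (by omega) hx hb'⟩
  have hsq0 : ∀ x, x ∈ cube L a M ρ k 0 ↔ InBox (sqLo L a ρ k 0) (sqHi L a M ρ k 0) x := fun x => by
    have := smul_mem_cube_iff hL a M ρ k 0 x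
    simpa [pow_zero, one_smul] using this
  have hin0 : ∀ x, InBox (inLo L a ρ k 0) (inHi L a M ρ k 0) x → x ∈ cube L a M ρ k 1 := fun x hx => by
    have := (smul_mem_cube_succ_iff hL a M ρ (by omega : 0 < k) x).2 hx
    simpa [pow_zero, one_smul] using this
  refine ⟨Nat.zero_le m, ?_, fun _ => ⟨fun h => ?_, fun h => ?_⟩⟩
  · rcases hbt with h | h
    · exact Or.inl ((hsq0 _).1 h)
    · exact Or.inr ((hsq0 _).1 h)
  · have h1 := hin0 _ h
    exact hnot ⟨h10 h1, (hcol _ h1 b.2).1⟩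
  · have h1 := hin0 _ h
    have h2 := (hcol _ h1 b.2).2
    rw [add_sub_cancel_right] at h2
    exact hnot ⟨h2, h10 h1⟩

/-- ★ **PRINT'S CLASS HAS CROSSING MEMBERS** (so the shell modes of `B8Ineq159FlatShellModeVacuity` meet a datum): at level `1` of any truncation
`m ≥ 1` the bond `⟨s − e₀, s⟩`, `s` = the lower corner of `□₁^{(1)}`, sticks out of `□₁^{(1)}` (its first end is outside) and belongs to
`cubeLamBP … m 1` (`d ≥ 1`, `ρ ≥ 1`). [cite: Balaban1985RegularSpaces, (1.31) p.82 («Γ_{b₋,x} ⊂ Λ_{j−1}»); Balaban1984PropagatorsII, (2.3) p.224] -/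
theorem crossing_mem_cubeLamBP_one (hd : 1 ≤ d) (L : ℕ) (a : Site d) (M : ℕ) {ρ : ℕ} (hρ : 1 ≤ ρ) (k : ℕ) {m : ℕ} (hm : 1 ≤ m) :
    (sqLo L a ρ k 1 - e ⟨0, hd⟩, (⟨0, hd⟩ : Fin d)) ∈ cubeLamBP L a M ρ k m 1 ∧
      ¬ InBox (sqLo L a ρ k 1) (sqHi L a M ρ k 1) (sqLo L a ρ k 1 - e ⟨0, hd⟩) := by
  have hρ' : (1 : ℤ) ≤ (ρ : ℤ) := by exact_mod_cast hρ
  have hout : ¬ InBox (sqLo L a ρ k 1) (sqHi L a M ρ k 1) (sqLo L a ρ k 1 - e ⟨0, hd⟩) := by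
    intro h
    have := (h ⟨0, hd⟩).1
    simp [e] at this
  have hnotin : ∀ z, InBox (inLo L a ρ k 1) (inHi L a M ρ k 1) z → sqLo L a ρ k 1 ⟨0, hd⟩ + 1 ≤ z ⟨0, hd⟩ := by
    intro z hz
    have h1 := (hz ⟨0, hd⟩).1
    have key : sqLo L a ρ k 1 ⟨0, hd⟩ + (ρ : ℤ) = inLo L a ρ k 1 ⟨0, hd⟩ := by
      have hg := one_le_gs L (k - 1)
      simp only [sqLo, inLo, B8Eq131Cubes.bLo]; push_cast [Nat.cast_sub hg]; ring
    linarith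
  refine ⟨⟨hm, Or.inr ?_, fun _ => ⟨fun h => ?_, fun h => ?_⟩⟩, hout⟩
  · rw [sub_add_cancel]; exact sqLo_inBox_one L a M hρ k
  · have := hnotin _ h
    simp [e] at this
  · have := hnotin _ h
    rw [sub_add_cancel] at this
    linarith

/-! ## §2 The named fact: (1.59) at `U₀ = 1` on the cube member, averaging datum over print's class -/

/-- **[Balaban1985RegularSpaces] (1.59) AT THE FLAT BACKGROUND `U₀ = 1` ON THE CUBE FAMILY `{□_j}` OF (1.131), AVERAGING DATUM OVER PRINT'S
CLASS** (= [Balaban1985BackgroundPropagators] Thm 3.3 at `U = 1` with Dirichlet exterior on `□₀`; [B6] Prop. 2.6 for the flat `Δ_a = ∂*∂ + ∂R∂* + Q*aQ`):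
there are `B₀ > 0` and thresholds `ρ₀, M₀, N₀, R₀` (functions of `d, L`) such that for every `η > 0`, every cube datum `(a, M, ρ, k)`, `k ≥ 1`, on print's
p. 98 big-block sub-lattice (`M_h = Lˢ`: `M₀ ≤ L^{s+1}`, `L^{s+1} ∣ ρ`, `L^{s+1} ∣ M`, `R·L^{s+1} ≤ ρ`, `R₀ ≤ R`, `N₀ + 1 ≤ R·L^{s+1}`, `ρ₀ ≤ ρ` — print's «R₁, M₁
the smallest integers for which all the theorems of [2, 4] are valid», «M a multiple of R₁M₁»), every
truncation `1 ≤ m ≤ k` and every ℂ-valued bond function `φ` on the bonds near `□₀` in the flat Landau gauge (1.38) (multiplier form, `Λ′`-tower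
`cubeLamS … m`): if `N ≥ 0` bounds (i) `(Lʲη)³|J(φ)|` on the bonds of `□_j` (`J = D^{η*}_1D^η_1φ`, (1.55)), (ii) the un-normalised flat averages
`|L^jη·Q_j(iηφ)(c)|` on EVERY bond `c` of PRINT'S class `cubeLamBP … m j` (inner AND crossing, (1.31)), and (iii) `η|φ|` on the outer layer (bonds
with no end in `□₀`), then on every bond side-touching `□_j`: `(Lʲη)|φ| ≤ B₀N`, `(Lʲη)²|D^η_{1,ν}φ_τ| ≤ B₀N` (all `ν`), `(Lʲη)³|Δ^η_1φ_τ| ≤ B₀N` — print's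
«|A|₍₋₁₎, |∇^η_{U₀}A|₍₋₂₎, |Δ^η_{U₀}A|₍₋₃₎ ≦ B₀(|J|₍₋₃₎ + |B₁|)» at `U₀ = 1` in the pointwise form «on Ω_j» (1.62).  Named, NOT proved here; the
transplant target of lit-balaban's torus-with-level-0 (1.59).
[cite: Balaban1985RegularSpaces, (1.59) p.86, (1.62) p.87, (1.31) p.82, (1.38) p.82, (1.131)–(1.132) p.99, p.98; Balaban1985BackgroundPropagators, Thm 3.3 p.399, (3.47) p.398; Balaban1984PropagatorsII, Prop. 2.6 (2.136) p.247, (2.3) p.224] -/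
def Ineq159FlatCubeMemberPrinted (d L : ℕ) : Prop :=
  ∃ B₀ ρ₀ M₀ : ℝ, ∃ N₀ R₀ : ℕ, 0 < B₀ ∧
    ∀ (η : ℝ), 0 < η → ∀ (a : Site d) (M ρ k s R : ℕ), 1 ≤ k →
      M₀ ≤ (L : ℝ) ^ (s + 1) → L ^ (s + 1) ∣ ρ → L ^ (s + 1) ∣ M → R * L ^ (s + 1) ≤ ρ → R₀ ≤ R →
      N₀ + 1 ≤ R * L ^ (s + 1) → ρ₀ ≤ (ρ : ℝ) →
      ∀ m, 1 ≤ m → m ≤ k → ∀ φ : Site d → Fin d → ℂ,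
        IsLandau138 L m η (cubeFam false L a M ρ k 0) (cubeLamS L a M ρ k m) (1 : Site d → Fin d → ℂˣ) φ →
        (∀ (y : Site d) (τ : Fin d), (∀ j, j ≤ m → ¬ SideTouches (cubeFam false L a M ρ k j) y τ) → φ y τ = 0) →
        ∀ N : ℝ, 0 ≤ N →
          (∀ j, j ≤ m → ∀ (y : Site d) (τ : Fin d), BondTouches (cubeFam false L a M ρ k j) y τ →
              ((L : ℝ) ^ j * η) ^ 3 * ‖Jcur η (1 : Site d → Fin d → ℂˣ) φ τ y‖ ≤ N) →
          (∀ j, j ≤ m → ∀ c ∈ cubeLamBP L a M ρ k m j,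
              ‖linCovIter L (1 : Site d → Fin d → ℂˣ) (iEta η φ) j c.1 c.2‖ ≤ N) →
          (∀ (y : Site d) (τ : Fin d), ¬ BondTouches (cubeFam false L a M ρ k 0) y τ → η * ‖φ y τ‖ ≤ N) →
          ∀ j, j ≤ m → ∀ (y : Site d) (τ : Fin d), SideTouches (cubeFam false L a M ρ k j) y τ →
            ((L : ℝ) ^ j * η) * ‖φ y τ‖ ≤ B₀ * N ∧
            (∀ ν : Fin d, ((L : ℝ) ^ j * η) ^ 2 * ‖covDerivFwd η (1 : Site d → Fin d → ℂˣ) ν (fun z => φ z τ) y‖ ≤ B₀ * N) ∧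
            ((L : ℝ) ^ j * η) ^ 3 * ‖covLap η (1 : Site d → Fin d → ℂˣ) (fun z => φ z τ) y‖ ≤ B₀ * N


/-! ## §3 (v1.1) The locality box of a bond of print's class lies one cube further out -/

/-- ★ **THE FINE BOX `Bʲ(c₋) ∪ Bʲ(c₊)` OF A LEVEL-`j` BOND OF PRINT'S CLASS LIES IN `□_{j−1}`** (`1 ≤ j ≤ m ≤ k`, `L ≤ ρ`): the end in `□_j^{(j)}`
carries its block inside `□_j`, the other block is a translate by `±Lʲe_κ`, `Lʲ ≤ ρ·L^{j−1}` = the collar width — print's «all sites of the contours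
Γ_{b₋,x} belong to Λ_{j−1}» read as the box law «box ⊂ Ω_{j−1}» the repaired driver needs (dag-n05-e CONSUMER-REQS (R1)).
[cite: Balaban1985RegularSpaces, (1.31) p.82, (1.131) p.99, p.98 («a distance between boundaries of these cubes is equal to R₁M₁Lʲη»)] -/
theorem cubeLamBP_box_subset_pred {L : ℕ} (hL : 1 ≤ L) (a : Site d) (M : ℕ) {ρ : ℕ} (hρ : L ≤ ρ) {k m j : ℕ} (hj : 1 ≤ j)
    (hmk : m ≤ k) {c : Site d × Fin d} (hc : c ∈ cubeLamBP L a M ρ k m j) :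
    ∀ x, InBox (loK L j c.1) (bondHiK L j c.1 c.2) x → x ∈ cube L a M ρ k (j - 1) := by
  obtain ⟨hjm, hends, -⟩ := hc
  have hjk : j ≤ k := hjm.trans hmk
  obtain ⟨n, rfl⟩ : ∃ n, j = n + 1 := ⟨j - 1, by omega⟩
  rw [Nat.add_sub_cancel]
  have hnk : n < k := by omega
  have hLj : (0 : ℤ) < (L : ℤ) ^ (n + 1) := by positivity
  -- the shift `± L^{n+1} e_κ` stays within the collar `ρ·Lⁿ`
  have hshift : ∀ (s : ℤ), (s = 1 ∨ s = -1) → ∀ i, |((s * (L : ℤ) ^ (n + 1)) • (e c.2 : Site d)) i| ≤ ((ρ * L ^ n : ℕ) : ℤ) := by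
    intro s hs i
    have hρL : (L : ℤ) ^ (n + 1) ≤ ((ρ * L ^ n : ℕ) : ℤ) := by
      push_cast
      rw [pow_succ, mul_comm]
      exact mul_le_mul_of_nonneg_right (by exact_mod_cast hρ) (by positivity)
    change |(s * (L : ℤ) ^ (n + 1)) * (Pi.single c.2 (1 : ℤ) : Site d) i| ≤ _
    rw [Pi.single_apply]
    split_ifs
    · rcases hs with rfl | rfl <;> simp [abs_of_pos hLj] <;> exact hρL
    · simp only [mul_zero, abs_zero]; positivity
  -- a point of the box lies in `Bʲ(c₋)` or in `Bʲ(c₊) = Bʲ(c₋) + Lʲe_κ`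
  have hsplit : ∀ x, InBox (loK L (n + 1) c.1) (bondHiK L (n + 1) c.1 c.2) x →
      Under L (n + 1) c.1 x ∨ Under L (n + 1) (c.1 + e c.2) x := by
    intro x hx
    by_cases hκ : x c.2 + 1 ≤ (L : ℤ) ^ (n + 1) * (c.1 c.2 + 1)
    · refine Or.inl fun i => ?_
      obtain ⟨h1, h2⟩ := hx i
      simp only [loK, bondHiK] at h1 h2
      by_cases hi : i = c.2
      · subst hi; exact ⟨h1, hκ⟩
      · rw [if_neg hi] at h2; constructor <;> linarith
    · refine Or.inr fun i => ?_
      obtain ⟨h1, h2⟩ := hx i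
      simp only [loK, bondHiK] at h1 h2
      simp only [Pi.add_apply, e, Pi.single_apply]
      by_cases hi : i = c.2
      · subst hi; simp only [if_true] at h2 ⊢; constructor <;> linarith
      · rw [if_neg hi] at h2; rw [if_neg hi]; constructor <;> linarith
  -- blocks of `□_j^{(j)}`-sites lie in `□_j ⊂ □_{j−1}`
  have hblk : ∀ z, InBox (sqLo L a ρ k (n + 1)) (sqHi L a M ρ k (n + 1)) z → ∀ x, Under L (n + 1) z x → x ∈ cube L a M ρ k (n + 1) :=
    fun z hz x hx => (mem_cube_iff hL).2 ⟨z, hz, hx⟩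
  have hsub : cube L a M ρ k (n + 1) ⊆ cube L a M ρ k n := cube_succ_subset hnk
  -- translating membership in a block along `e_κ`
  have htrans : ∀ z x, Under L (n + 1) (z + e c.2) x → Under L (n + 1) z (x + ((-1 : ℤ) * (L : ℤ) ^ (n + 1)) • e c.2) := by
    intro z x hx i
    obtain ⟨h1, h2⟩ := hx i
    by_cases hi : i = c.2
    · subst hi
      simp only [Pi.add_apply, Pi.smul_apply, smul_eq_mul, e, Pi.single_eq_same] at h1 h2 ⊢
      constructor <;> linarith
    · simp only [Pi.add_apply, Pi.smul_apply, smul_eq_mul, e, Pi.single_eq_of_ne hi, mul_zero, add_zero] at h1 h2 ⊢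
      exact ⟨h1, h2⟩
  have htrans' : ∀ z x, Under L (n + 1) z x → Under L (n + 1) (z + e c.2) (x + ((1 : ℤ) * (L : ℤ) ^ (n + 1)) • e c.2) := by
    intro z x hx i
    obtain ⟨h1, h2⟩ := hx i
    by_cases hi : i = c.2
    · subst hi
      simp only [Pi.add_apply, Pi.smul_apply, smul_eq_mul, e, Pi.single_eq_same] at h1 h2 ⊢
      constructor <;> linarith
    · simp only [Pi.add_apply, Pi.smul_apply, smul_eq_mul, e, Pi.single_eq_of_ne hi, mul_zero, add_zero] at h1 h2 ⊢
      exact ⟨h1, h2⟩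
  intro x hx
  rcases hends with hm | hp
  · -- `c₋ ∈ □_j^{(j)}`
    rcases hsplit x hx with h | h
    · exact hsub (hblk _ hm x h)
    · have hy : x + ((-1 : ℤ) * (L : ℤ) ^ (n + 1)) • e c.2 ∈ cube L a M ρ k (n + 1) := hblk _ hm _ (htrans _ x h)
      have := add_mem_cube_of_mem_succ hnk hy (hshift 1 (Or.inl rfl))
      rwa [add_assoc, ← add_smul, show (-1 : ℤ) * (L : ℤ) ^ (n + 1) + 1 * (L : ℤ) ^ (n + 1) = 0 by ring, zero_smul,
        add_zero] at this
  · -- `c₊ ∈ □_j^{(j)}`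
    rcases hsplit x hx with h | h
    · have hy : x + ((1 : ℤ) * (L : ℤ) ^ (n + 1)) • e c.2 ∈ cube L a M ρ k (n + 1) := hblk _ hp _ (htrans' _ x h)
      have := add_mem_cube_of_mem_succ hnk hy (hshift (-1) (Or.inr rfl))
      rwa [add_assoc, ← add_smul, show (1 : ℤ) * (L : ℤ) ^ (n + 1) + -1 * (L : ℤ) ^ (n + 1) = 0 by ring, zero_smul,
        add_zero] at this
    · exact hsub (hblk _ hp x h)

/-- **At level `0` a bond of print's class has an end in `□₀`** (the other may lie outside: the crossing bonds of `□₀`). [cite: Balaban1984PropagatorsII, (2.3) p.224; Balaban1985RegularSpaces, p.77] -/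
theorem cubeLamBP_zero_bondTouches (L : ℕ) (a : Site d) (M ρ k m : ℕ) {c : Site d × Fin d} (hc : c ∈ cubeLamBP L a M ρ k m 0) :
    BondTouches (cube L a M ρ k 0) c.1 c.2 := by
  obtain ⟨-, hends, -⟩ := hc
  have hsq0 : ∀ x, InBox (sqLo L a ρ k 0) (sqHi L a M ρ k 0) x → x ∈ cube L a M ρ k 0 := fun x hx => by
    simpa [cube, B8Ineq130.tlo_zero, B8Ineq130.thi_zero] using hx
  rcases hends with h | h
  · exact Or.inl (hsq0 _ h)
  · exact Or.inr (hsq0 _ h)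

end Literature.MathematicalPhysics.QuantumFieldTheory.Balaban1983to89.B8Ineq159FlatCubeMemberPrinted

end
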